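import Mathlib

/-!
# Two-mode glue — the converse direction
(registered sub-goal `twoMode_glue_converse` of line `Sketch`, crux stmt-AtomisticToContinuum-12111
`PuiseuxTransferLedger.TwoModeBulk`)

Pure real analysis, companion of `twoMode_glue` (`…TwoModeBulkGlue.lean`). For profiles `u N : Fin (N+1) → ℝ` and
per-bond scales `g N`, the TWO-MODE form of the increments,
`|u N i - u N (i+1) - r · g N| ≤ C |g N| (θ^i + θ^(N-1-i))` with `θ ∈ [0,1)`, `C` independent of `N`,
gives back BOTH hypotheses of `twoMode_glue` with `N`-independent constants:
* LAYER RELAXATION of the second differences with the same rate `θ` and constant `2 max C 0`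
  (difference of two consecutive increments);
* BULK SLOPE at the middle bond `N/2` with rate `√(max θ ¼) ∈ [½, 1)` and constant `10 max C 0`
  (`θ^(N/2) + θ^(N-1-N/2) ≤ 10 (√τ)^N` for `τ = max θ ¼`, integer-division bookkeeping).
Hence "layer relaxation ∧ bulk slope" is EQUIVALENT (up to constants) to the two-mode form; instantiated at the explicit
equilibrium Kubo profile of the pinned chain this says that the two registered `N`-uniform stubs `stub_layerRelaxation`,
`stub_bulkSlope` are jointly equivalent to `TwoModeProfile`, i.e. (by `twoModeBulk_iff_twoModeProfile`) to the crux itself.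
No definitions.
-/

namespace Summit.AtomisticToContinuum.FouriersLaw.Theorems.TwoModeBulk.Sketch

/-- Integer-division bookkeeping for the bulk-slope rate: for `0 < τ < 1` with `¼ ≤ τ` (so `½ ≤ √τ`),
`τ^(N/2) ≤ 2 (√τ)^N` and `τ^(N-1-N/2) ≤ 8 (√τ)^N`. [folklore] -/
theorem pow_half_le_sqrt_pow {τ : ℝ} (hτ0 : 0 < τ) (hτ1 : τ < 1) (hτq : 1 / 4 ≤ τ) (N : ℕ) :
    τ ^ (N / 2) ≤ 2 * Real.sqrt τ ^ N ∧ τ ^ (N - 1 - N / 2) ≤ 8 * Real.sqrt τ ^ N := by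
  set s : ℝ := Real.sqrt τ with hs
  have hs0 : 0 ≤ s := Real.sqrt_nonneg _
  have hss : s * s = τ := Real.mul_self_sqrt hτ0.le
  have hshalf : 1 / 2 ≤ s := by
    have h14 : Real.sqrt (1 / 4) = 1 / 2 := by
      rw [show (1 / 4 : ℝ) = (1 / 2) ^ 2 by norm_num, Real.sqrt_sq (by norm_num)]
    rw [← h14]
    exact Real.sqrt_le_sqrt hτq
  have hτmono : ∀ {a b : ℕ}, a ≤ b → τ ^ b ≤ τ ^ a := fun hab => pow_le_pow_of_le_one hτ0.le hτ1.le hab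
  have hsN : τ ^ (N / 2) ≤ 2 * s ^ N := by
    have hN : N = 2 * (N / 2) + N % 2 := (Nat.div_add_mod N 2).symm
    have e : s ^ N = τ ^ (N / 2) * s ^ (N % 2) := by
      conv_lhs => rw [hN]
      rw [pow_add, pow_mul, ← hss, ← sq]
    rw [e]
    have hmod : 1 / 2 ≤ s ^ (N % 2) := by
      rcases Nat.mod_two_eq_zero_or_one N with h | h
      · rw [h, pow_zero]; norm_num
      · rw [h, pow_one]; exact hshalf
    have hτp : 0 ≤ τ ^ (N / 2) := pow_nonneg hτ0.le _
    nlinarith [mul_le_mul_of_nonneg_left hmod hτp]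
  refine ⟨hsN, ?_⟩
  have hle : τ ^ (N - 1 - N / 2) ≤ τ ^ (N / 2 - 1) := hτmono (by omega)
  have hle2 : τ ^ (N / 2 - 1) ≤ 4 * τ ^ (N / 2) := by
    rcases Nat.eq_zero_or_pos (N / 2) with hz | hpz
    · rw [hz]; norm_num
    · have e : τ ^ (N / 2) = τ ^ (N / 2 - 1) * τ := by
        rw [← pow_succ]; congr 1; omega
      rw [e]
      have hp : 0 ≤ τ ^ (N / 2 - 1) := pow_nonneg hτ0.le _
      nlinarith [mul_le_mul_of_nonneg_left hτq hp]
  linarith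

/-- **Two-mode glue, converse.** The two-mode form of the increments (rate `θ`, constant `C`, both independent of
`N`) implies (i) layer relaxation of the second differences (rate `θ`, constant `2 max C 0`) and (ii) the bulk-slope
estimate at the middle bond (rate `√(max θ ¼)`, constant `10 max C 0`). [folklore] -/
theorem twoMode_glue_converse :
    ∀ (u : (N : ℕ) → Fin (N + 1) → ℝ) (g : ℕ → ℝ),
      (∃ r θ C : ℝ, 0 ≤ θ ∧ θ < 1 ∧ ∀ (N : ℕ) (i j : Fin (N + 1)), j.val = i.val + 1 →
        |u N i - u N j - r * g N| ≤ C * |g N| * (θ ^ i.val + θ ^ (N - 1 - i.val))) →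
      (∃ θ C : ℝ, 0 ≤ θ ∧ θ < 1 ∧ ∀ (N : ℕ) (i j k : Fin (N + 1)), j.val = i.val + 1 → k.val = i.val + 2 →
        |u N i - 2 * u N j + u N k| ≤ C * |g N| * (θ ^ i.val + θ ^ (N - 2 - i.val))) ∧
      (∃ r θ C : ℝ, 0 ≤ θ ∧ θ < 1 ∧ ∀ (N : ℕ) (i j : Fin (N + 1)), i.val = N / 2 → j.val = i.val + 1 →
        |u N i - u N j - r * g N| ≤ C * |g N| * θ ^ N) := by
  intro u g ⟨r, θ, C, h0, h1, hP⟩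
  have hC0 : 0 ≤ max C 0 := le_max_right _ _
  have hCle : C ≤ max C 0 := le_max_left _ _
  -- upgrade the constant to `max C 0`
  have hP' : ∀ (N : ℕ) (i j : Fin (N + 1)), j.val = i.val + 1 →
      |u N i - u N j - r * g N| ≤ max C 0 * |g N| * (θ ^ i.val + θ ^ (N - 1 - i.val)) := by
    intro N i j hij
    refine (hP N i j hij).trans ?_
    have hS : 0 ≤ |g N| * (θ ^ i.val + θ ^ (N - 1 - i.val)) :=
      mul_nonneg (abs_nonneg _) (add_nonneg (pow_nonneg h0 _) (pow_nonneg h0 _))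
    have := mul_le_mul_of_nonneg_right hCle hS
    linarith [mul_assoc C (|g N|) (θ ^ i.val + θ ^ (N - 1 - i.val)),
      mul_assoc (max C 0) (|g N|) (θ ^ i.val + θ ^ (N - 1 - i.val))]
  have hθmono : ∀ {a b : ℕ}, a ≤ b → θ ^ b ≤ θ ^ a := fun hab => pow_le_pow_of_le_one h0 h1.le hab
  constructor
  · -- (i) layer relaxation
    refine ⟨θ, 2 * max C 0, h0, h1, ?_⟩
    intro N i j k hij hik
    have hk := k.isLt
    have hjk : k.val = j.val + 1 := by omega
    have h1' := hP' N i j hij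
    have h2' := hP' N j k hjk
    rw [hij] at h2'
    have e : u N i - 2 * u N j + u N k = (u N i - u N j - r * g N) - (u N j - u N k - r * g N) := by ring
    rw [e]
    refine (abs_sub _ _).trans ((add_le_add h1' h2').trans ?_)
    have hA : θ ^ (i.val + 1) ≤ θ ^ i.val := hθmono (by omega)
    have hB : θ ^ (N - 1 - i.val) ≤ θ ^ (N - 2 - i.val) := hθmono (by omega)
    have hB' : θ ^ (N - 1 - (i.val + 1)) ≤ θ ^ (N - 2 - i.val) := hθmono (by omega)
    have hg : 0 ≤ max C 0 * |g N| := mul_nonneg hC0 (abs_nonneg _)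
    have hsum : (θ ^ i.val + θ ^ (N - 1 - i.val)) + (θ ^ (i.val + 1) + θ ^ (N - 1 - (i.val + 1))) ≤
        2 * (θ ^ i.val + θ ^ (N - 2 - i.val)) := by linarith
    calc max C 0 * |g N| * (θ ^ i.val + θ ^ (N - 1 - i.val)) +
          max C 0 * |g N| * (θ ^ (i.val + 1) + θ ^ (N - 1 - (i.val + 1)))
        = max C 0 * |g N| * ((θ ^ i.val + θ ^ (N - 1 - i.val)) +
            (θ ^ (i.val + 1) + θ ^ (N - 1 - (i.val + 1)))) := by ring
      _ ≤ max C 0 * |g N| * (2 * (θ ^ i.val + θ ^ (N - 2 - i.val))) := mul_le_mul_of_nonneg_left hsum hg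
      _ = 2 * max C 0 * |g N| * (θ ^ i.val + θ ^ (N - 2 - i.val)) := by ring
  · -- (ii) bulk slope with rate `√τ`, `τ = max θ ¼`
    set τ : ℝ := max θ (1 / 4) with hτ
    have hτ0 : 0 < τ := lt_max_of_lt_right (by norm_num)
    have hτ1 : τ < 1 := max_lt h1 (by norm_num)
    have hθτ : θ ≤ τ := le_max_left _ _
    have hτq : 1 / 4 ≤ τ := le_max_right _ _
    have hs0 : 0 ≤ Real.sqrt τ := Real.sqrt_nonneg _
    have hs1 : Real.sqrt τ < 1 := by
      rw [show (1 : ℝ) = Real.sqrt 1 by simp]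
      exact Real.sqrt_lt_sqrt hτ0.le hτ1
    refine ⟨r, Real.sqrt τ, 10 * max C 0, hs0, hs1, ?_⟩
    intro N i j hi hij
    have h := hP' N i j hij
    rw [hi] at h
    have hpow1 : θ ^ (N / 2) ≤ τ ^ (N / 2) := pow_le_pow_left₀ h0 hθτ _
    have hpow2 : θ ^ (N - 1 - N / 2) ≤ τ ^ (N - 1 - N / 2) := pow_le_pow_left₀ h0 hθτ _
    obtain ⟨hsN, hsN2⟩ := pow_half_le_sqrt_pow hτ0 hτ1 hτq N
    have hg : 0 ≤ max C 0 * |g N| := mul_nonneg hC0 (abs_nonneg _)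
    calc |u N i - u N j - r * g N| ≤ max C 0 * |g N| * (θ ^ (N / 2) + θ ^ (N - 1 - N / 2)) := h
      _ ≤ max C 0 * |g N| * (2 * Real.sqrt τ ^ N + 8 * Real.sqrt τ ^ N) := by
          apply mul_le_mul_of_nonneg_left _ hg
          linarith
      _ = 10 * max C 0 * |g N| * Real.sqrt τ ^ N := by ring

end Summit.AtomisticToContinuum.FouriersLaw.Theorems.TwoModeBulk.Sketch
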